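import Summits.CriticalPhenomena.PercolationContinuityZ3.Theorems.SahiMasterFamilyFInequalityTwistedMaricaSchonheim
import Literature.Combinatorics.SetFamily.AhlswedeDaykinDifferences

/-!
# Proved cases of the abstract twisted Marica–Schönheim conjecture (AMS)

Support file for the master-family `F`-inequality programme (`prim-master-conj` gen 26; `--supports stmt-CriticalPhenomena-4575`;
memo `run/shared/lean/prim/prim-l12/prim-master-conj/POINTWISE.md` §27).  No definition, no `sorry`, standard axioms.

Recall (`SahiMasterFamilyFInequalityTwistedMaricaSchonheim`, `TwistedAD.AMSWeighted`): for a complement-closed family `S` of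
points of the cube and a relation `R` (there an equivalence relation with `¬ R x xᶜ` on `S`), the *admissible unions* are
`J(S,R) = {x ∪ z : x, z ∈ S, ¬R x z, ¬R xᶜ zᶜ}`, and (AMS) asserts `Σ_{x∈S} ω x ≤ 2·Σ_{u ∈ J(S,R)} ω u`; the tree has
`(AMS) ⟹ (KC) ⟹ WF_comb ≥ 0 on the class G ⊆ A ∪ B`.  (AMS) is OPEN in general (the open content is a "class graph" which is
not bipartite, POINTWISE §26.7/§27).  This file puts the two PROVED regimes in the kernel, for an ARBITRARY relation `R`:

* `compls_diffs_subset_amsUnions` — the dictionary between differences and admissible unions: if `W, X ⊆ S` and every pair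
  `(w, x) ∈ W × X` has `¬R wᶜ x` and `¬R w xᶜ`, then `(W \\ X)ᶜˢ ⊆ J(S,R)` (`(w \ x)ᶜ = wᶜ ∪ x`).
* `amsIneq_of_section` — **the sectioned (bipartite) case, weighted**: if `P ⊆ S` meets every antipodal pair of `S` and all pairs
  `(x, wᶜ)`, `x, w ∈ P`, are admissible, then `Σ_S ω ≤ 2·Σ_{J} ω` for every complement-invariant FKG weight `ω ≥ 0`
  (weighted Marica–Schönheim `TwistedAD.weighted_marica_schonheim` applied to `P`).  `amsIneq_of_twoColouring` — the form used in
  practice: `R` refines a two-colouring `f` of `S` with `f xᶜ ≠ f x`; for an equivalence relation `R` this is exactly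
  "the class graph is bipartite", so the kernel now records that the open content of (AMS) is the non-bipartite case.
* `card_le_card_amsUnions_of_forall_exists_subset` — **the containment case, counting** (via the Ahlswede–Daykin difference
  inequality `Literature.Combinatorics.SetFamily.card_le_card_diffs_of_forall_exists_subset`, Ahlswede–Blinovsky Thm 37): if
  `W, X ⊆ S` are cross-admissible as above and every `w ∈ W` contains some `x ∈ X`, then `#W ≤ #J(S,R)`; hence
  (`ams_card_of_forall_exists_subset`) the counting form `#S ≤ 2·#J(S,R)` holds as soon as such a `W` has `2·#W ≥ #S`.
  For a labelling with three labels `a, b, c` this applies with `X = X_{ab}` (points labelled `a` whose antipode is labelled `b`)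
  and `W = X_{ab} ∪ X_{ac} ∪ X_{cb}` (`#W = #S/2`): (AMS) holds for every instance in which each point of `X_{ac} ∪ X_{cb}` lies
  above some point of `X_{ab}` (twelve such sufficient conditions by symmetry; POINTWISE §27 (R8)).

HONEST FRAMING: special cases of an OPEN conjecture; the reductions to `F ≥ 0` are in the imported files. [this work]
-/

namespace Summit.CriticalPhenomena.PercolationContinuityZ3.Theorems

namespace TwistedAD

open Finset
open scoped FinsetFamily Classical

variable {κ : Type*} [Fintype κ] [DecidableEq κ]

/-! ### Differences versus admissible unions -/

/-- Complement of a difference: `(w \ x)ᶜ = wᶜ ∪ x`. [this work] -/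
theorem compl_sdiff_eq_compl_union (w x : Finset κ) : (w \ x)ᶜ = wᶜ ∪ x := by
  ext i
  simp only [mem_compl, mem_sdiff, mem_union, not_and, not_not]
  tauto

/-- **Dictionary.**  For `W, X ⊆ S` (`S` complement-closed) such that every pair `(w, x) ∈ W × X` satisfies `¬R wᶜ x` and
`¬R w xᶜ`, every complemented difference `(w \ x)ᶜ = wᶜ ∪ x` is an admissible union of `(S, R)`:
`(W \\ X)ᶜˢ ⊆ J(S,R) = image (∪) {(p₁,p₂) ∈ S × S : ¬R p₁ p₂ ∧ ¬R p₁ᶜ p₂ᶜ}`. [this work] -/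
theorem compls_diffs_subset_amsUnions (S : Finset (Finset κ)) (R : Finset κ → Finset κ → Prop)
    (hScl : ∀ x ∈ S, xᶜ ∈ S) (W X : Finset (Finset κ)) (hW : W ⊆ S) (hX : X ⊆ S)
    (hadm : ∀ w ∈ W, ∀ x ∈ X, ¬ R wᶜ x ∧ ¬ R w xᶜ) :
    (W \\ X)ᶜˢ ⊆ ((S ×ˢ S).filter (fun p => ¬ R p.1 p.2 ∧ ¬ R p.1ᶜ p.2ᶜ)).image (fun p => p.1 ∪ p.2) := by
  intro u hu
  rw [mem_compls, mem_diffs] at hu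
  obtain ⟨w, hw, x, hx, hwx⟩ := hu
  rw [mem_image]
  refine ⟨(wᶜ, x), ?_, ?_⟩
  · rw [mem_filter, mem_product]
    refine ⟨⟨hScl w (hW hw), hX hx⟩, (hadm w hw x hx).1, ?_⟩
    rw [compl_compl]
    exact (hadm w hw x hx).2
  · show wᶜ ∪ x = u
    rw [← compl_sdiff_eq_compl_union, hwx, compl_compl]

/-! ### The sectioned (bipartite) case, for complement-invariant FKG weights -/

/-- **(AMS), sectioned case.**  Let `ω ≥ 0` be a complement-invariant weight with the FKG lattice condition, `S` complement-closed,
and `P ⊆ S` a family meeting every antipodal pair of `S` (`x ∈ S ⟹ x ∈ P ∨ xᶜ ∈ P`) such that for all `x, w ∈ P` the pair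
`(xᶜ, w)` is admissible: `¬R xᶜ w ∧ ¬R x wᶜ`.  Then `Σ_{x∈S} ω x ≤ 2·Σ_{u∈J(S,R)} ω u`.
Proof: `J ⊇ (P \\ P)ᶜˢ`, `ω((P \\ P)ᶜˢ) = ω(P \\ P) ≥ ω(P)` (weighted Marica–Schönheim), `ω(S) ≤ ω(P) + ω(Pᶜˢ) = 2ω(P)`. [this work] -/
theorem amsIneq_of_section (ω : Finset κ → ℝ) (hω₀ : ∀ s, 0 ≤ ω s)
    (hω : ∀ s t, ω s * ω t ≤ ω (s ⊓ t) * ω (s ⊔ t)) (hsym : ∀ s, ω sᶜ = ω s)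
    (S P : Finset (Finset κ)) (R : Finset κ → Finset κ → Prop) (hScl : ∀ x ∈ S, xᶜ ∈ S) (hPS : P ⊆ S)
    (hcov : ∀ x ∈ S, x ∈ P ∨ xᶜ ∈ P) (hadm : ∀ x ∈ P, ∀ w ∈ P, ¬ R xᶜ w ∧ ¬ R x wᶜ) :
    ∑ x ∈ S, ω x ≤ 2 * ∑ u ∈ ((S ×ˢ S).filter (fun p => ¬ R p.1 p.2 ∧ ¬ R p.1ᶜ p.2ᶜ)).image (fun p => p.1 ∪ p.2), ω u := by
  set J := ((S ×ˢ S).filter (fun p => ¬ R p.1 p.2 ∧ ¬ R p.1ᶜ p.2ᶜ)).image (fun p => p.1 ∪ p.2) with hJ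
  have hsub : (P \\ P)ᶜˢ ⊆ J := compls_diffs_subset_amsUnions S R hScl P P hPS hPS hadm
  have h1 : ∑ u ∈ (P \\ P)ᶜˢ, ω u ≤ ∑ u ∈ J, ω u := sum_le_sum_of_subset_of_nonneg hsub fun u _ _ => hω₀ u
  have h2 : ∑ u ∈ (P \\ P)ᶜˢ, ω u = ∑ u ∈ P \\ P, ω u := sum_compls_eq ω hsym _
  have h3 : ∑ x ∈ P, ω x ≤ ∑ u ∈ P \\ P, ω u := weighted_marica_schonheim ω hω₀ hω hsym P
  have hScov : S ⊆ P ∪ Pᶜˢ := by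
    intro x hx
    rcases hcov x hx with h | h
    · exact mem_union.2 (Or.inl h)
    · exact mem_union.2 (Or.inr (mem_compls.2 h))
  have h4 : ∑ x ∈ S, ω x ≤ ∑ x ∈ P, ω x + ∑ x ∈ Pᶜˢ, ω x := by
    calc ∑ x ∈ S, ω x ≤ ∑ x ∈ P ∪ Pᶜˢ, ω x := sum_le_sum_of_subset_of_nonneg hScov fun x _ _ => hω₀ x
      _ = ∑ x ∈ P, ω x + ∑ x ∈ Pᶜˢ \ P, ω x := by
          rw [← sum_union disjoint_sdiff, union_sdiff_self_eq_union]
      _ ≤ ∑ x ∈ P, ω x + ∑ x ∈ Pᶜˢ, ω x := by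
          have : ∑ x ∈ Pᶜˢ \ P, ω x ≤ ∑ x ∈ Pᶜˢ, ω x :=
            sum_le_sum_of_subset_of_nonneg sdiff_subset fun x _ _ => hω₀ x
          linarith
  have h5 : ∑ x ∈ Pᶜˢ, ω x = ∑ x ∈ P, ω x := sum_compls_eq ω hsym P
  linarith

/-- **(AMS) for a relation refining an antipodal two-colouring** ("bipartite class graph").  If `f : Finset κ → Bool` has
`f xᶜ ≠ f x` on `S` and `R x z → f x = f z` for `x, z ∈ S`, then `Σ_{x∈S} ω x ≤ 2·Σ_{u∈J(S,R)} ω u` for every complement-invariant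
FKG weight `ω ≥ 0` (apply `amsIneq_of_section` to the colour class `P = {x ∈ S : f x = true}`).  For an equivalence relation `R`
(a labelling) this is the case of a bipartite class graph; with two classes and `ω ≡ 1` it is the Marica–Schönheim inequality.
[this work] -/
theorem amsIneq_of_twoColouring (ω : Finset κ → ℝ) (hω₀ : ∀ s, 0 ≤ ω s)
    (hω : ∀ s t, ω s * ω t ≤ ω (s ⊓ t) * ω (s ⊔ t)) (hsym : ∀ s, ω sᶜ = ω s)
    (S : Finset (Finset κ)) (R : Finset κ → Finset κ → Prop) (hScl : ∀ x ∈ S, xᶜ ∈ S)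
    (f : Finset κ → Bool) (hf : ∀ x ∈ S, f xᶜ ≠ f x) (hR : ∀ x ∈ S, ∀ z ∈ S, R x z → f x = f z) :
    ∑ x ∈ S, ω x ≤ 2 * ∑ u ∈ ((S ×ˢ S).filter (fun p => ¬ R p.1 p.2 ∧ ¬ R p.1ᶜ p.2ᶜ)).image (fun p => p.1 ∪ p.2), ω u := by
  set P := S.filter (fun x => f x = true) with hP
  refine amsIneq_of_section ω hω₀ hω hsym S P R hScl (filter_subset _ _) ?_ ?_
  · intro x hx
    by_cases hfx : f x = true
    · exact Or.inl (mem_filter.2 ⟨hx, hfx⟩)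
    · refine Or.inr (mem_filter.2 ⟨hScl x hx, ?_⟩)
      have hne := hf x hx
      cases h : f xᶜ with
      | true => rfl
      | false =>
        exfalso
        rw [h] at hne
        cases h' : f x with
        | true => exact hfx h'
        | false => exact hne (by rw [h'])
  · intro x hx w hw
    obtain ⟨hxS, hfx⟩ := mem_filter.1 hx
    obtain ⟨hwS, hfw⟩ := mem_filter.1 hw
    have hxc : f xᶜ = false := by
      have hne := hf x hxS
      rw [hfx] at hne
      cases h : f xᶜ with
      | true => exact absurd h hne
      | false => rfl
    have hwc : f wᶜ = false := by
      have hne := hf w hwS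
      rw [hfw] at hne
      cases h : f wᶜ with
      | true => exact absurd h hne
      | false => rfl
    refine ⟨fun hRxw => ?_, fun hRxw => ?_⟩
    · have := hR xᶜ (hScl x hxS) w hwS hRxw
      rw [hxc, hfw] at this
      exact Bool.false_ne_true this
    · have := hR x hxS wᶜ (hScl w hwS) hRxw
      rw [hfx, hwc] at this
      exact Bool.false_ne_true this.symm

/-! ### The containment case (counting form), via the Ahlswede–Daykin difference inequality -/

/-- **(AMS), containment case (counting).**  For `S` complement-closed and `W, X ⊆ S` with all pairs `(w, x) ∈ W × X` satisfying
`¬R wᶜ x ∧ ¬R w xᶜ`: if every `w ∈ W` contains some `x ∈ X`, then `#W ≤ #J(S,R)`.  Proof: `#W ≤ #(W \\ X)` is the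
Ahlswede–Daykin difference inequality (`Literature.Combinatorics.SetFamily.card_le_card_diffs_of_forall_exists_subset`,
Ahlswede–Blinovsky Thm 37) and `(W \\ X)ᶜˢ ⊆ J(S,R)`. [this work] -/
theorem card_le_card_amsUnions_of_forall_exists_subset (S : Finset (Finset κ)) (R : Finset κ → Finset κ → Prop)
    (hScl : ∀ x ∈ S, xᶜ ∈ S) (W X : Finset (Finset κ)) (hW : W ⊆ S) (hX : X ⊆ S)
    (hadm : ∀ w ∈ W, ∀ x ∈ X, ¬ R wᶜ x ∧ ¬ R w xᶜ) (hcont : ∀ w ∈ W, ∃ x ∈ X, x ⊆ w) :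
    #W ≤ #(((S ×ˢ S).filter (fun p => ¬ R p.1 p.2 ∧ ¬ R p.1ᶜ p.2ᶜ)).image (fun p => p.1 ∪ p.2)) :=
  calc #W ≤ #(W \\ X) := Literature.Combinatorics.SetFamily.card_le_card_diffs_of_forall_exists_subset W X hcont
    _ = #((W \\ X)ᶜˢ) := (card_compls (W \\ X)).symm
    _ ≤ _ := card_le_card (compls_diffs_subset_amsUnions S R hScl W X hW hX hadm)

/-- **(AMS) in counting form from a large contained-witness family.**  Under the hypotheses of
`card_le_card_amsUnions_of_forall_exists_subset`, if moreover `#S ≤ 2·#W` then `#S ≤ 2·#J(S,R)` — the `ω ≡ 1` instance of the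
(AMS) inequality for `(S, R)`.  Example (three labels `a,b,c`, types `X_{ℓm}` = points labelled `ℓ` with antipode labelled `m`):
`X = X_{ab}`, `W = X_{ab} ∪ X_{ac} ∪ X_{cb}` (`#W = #S/2`, all pairs cross-admissible), provided every point of `X_{ac} ∪ X_{cb}`
contains a point of `X_{ab}`. [this work] -/
theorem ams_card_of_forall_exists_subset (S : Finset (Finset κ)) (R : Finset κ → Finset κ → Prop)
    (hScl : ∀ x ∈ S, xᶜ ∈ S) (W X : Finset (Finset κ)) (hW : W ⊆ S) (hX : X ⊆ S)
    (hadm : ∀ w ∈ W, ∀ x ∈ X, ¬ R wᶜ x ∧ ¬ R w xᶜ) (hcont : ∀ w ∈ W, ∃ x ∈ X, x ⊆ w) (hbig : #S ≤ 2 * #W) :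
    #S ≤ 2 * #(((S ×ˢ S).filter (fun p => ¬ R p.1 p.2 ∧ ¬ R p.1ᶜ p.2ᶜ)).image (fun p => p.1 ∪ p.2)) :=
  hbig.trans (Nat.mul_le_mul_left 2
    (card_le_card_amsUnions_of_forall_exists_subset S R hScl W X hW hX hadm hcont))

/-! ### Bottom witnesses: every antipodal pair meets the admissible unions (appended, gen 26) -/

/-- **Pair lemma.**  Let `R` be an equivalence relation with `¬R x xᶜ` on the complement-closed family `S`, and let `u ∈ S`.  If there are
`m₁, m₂ ∈ S` of the SAME TYPE (`R m₁ m₂` and `R m₁ᶜ m₂ᶜ`) with `m₁ ⊆ u` and `m₂ ⊆ uᶜ`, then `u` or `uᶜ` is an admissible union: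
`u ∈ J(S,R) ∨ uᶜ ∈ J(S,R)`.  Proof: otherwise the pairs `(m₁, u)` and `(m₂, uᶜ)` (whose unions are `u`, `uᶜ`) are both inadmissible, i.e.
`(R m₁ u ∨ R m₁ᶜ uᶜ) ∧ (R m₂ uᶜ ∨ R m₂ᶜ u)`, and each of the four cases chains to `R u uᶜ` or `R m₁ m₁ᶜ`.  The case `m₁ = m₂ = ∅` shows:
if `∅ ∈ S` then every antipodal pair of `S` meets `J(S,R)`. [this work] -/
theorem mem_amsUnions_or_compl_mem_of_witnesses (S : Finset (Finset κ)) (R : Finset κ → Finset κ → Prop) (hR : Equivalence R)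
    (hScl : ∀ x ∈ S, xᶜ ∈ S) (hanti : ∀ x ∈ S, ¬ R x xᶜ) {u m₁ m₂ : Finset κ} (hu : u ∈ S) (hm₁ : m₁ ∈ S) (hm₂ : m₂ ∈ S)
    (h₁ : m₁ ⊆ u) (h₂ : m₂ ⊆ uᶜ) (ht : R m₁ m₂) (ht' : R m₁ᶜ m₂ᶜ) :
    u ∈ ((S ×ˢ S).filter (fun p => ¬ R p.1 p.2 ∧ ¬ R p.1ᶜ p.2ᶜ)).image (fun p => p.1 ∪ p.2) ∨
      uᶜ ∈ ((S ×ˢ S).filter (fun p => ¬ R p.1 p.2 ∧ ¬ R p.1ᶜ p.2ᶜ)).image (fun p => p.1 ∪ p.2) := by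
  by_contra hcon
  rw [not_or] at hcon
  obtain ⟨hu1, hu2⟩ := hcon
  -- the pair (m₁, u) is inadmissible
  have in1 : R m₁ u ∨ R m₁ᶜ uᶜ := by
    by_contra h
    rw [not_or] at h
    exact hu1 (mem_image.2 ⟨(m₁, u), mem_filter.2 ⟨mem_product.2 ⟨hm₁, hu⟩, h.1, h.2⟩, union_eq_right.2 h₁⟩)
  -- the pair (m₂, uᶜ) is inadmissible
  have in2 : R m₂ uᶜ ∨ R m₂ᶜ uᶜᶜ := by
    by_contra h
    rw [not_or] at h
    exact hu2 (mem_image.2 ⟨(m₂, uᶜ), mem_filter.2 ⟨mem_product.2 ⟨hm₂, hScl u hu⟩, h.1, h.2⟩, union_eq_right.2 h₂⟩)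
  rw [compl_compl] at in2
  have hu' : ¬ R u uᶜ := hanti u hu
  have hm' : ¬ R m₁ m₁ᶜ := hanti m₁ hm₁
  rcases in1 with a | a <;> rcases in2 with b | b
  · -- R m₁ u, R m₂ uᶜ : u ~ m₁ ~ m₂ ~ uᶜ
    exact hu' (hR.trans (hR.trans (hR.symm a) ht) b)
  · -- R m₁ u, R m₂ᶜ u : m₁ ~ u ~ m₂ᶜ ~ m₁ᶜ
    exact hm' (hR.trans (hR.trans a (hR.symm b)) (hR.symm ht'))
  · -- R m₁ᶜ uᶜ, R m₂ uᶜ : m₁ᶜ ~ uᶜ ~ m₂ ~ m₁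
    exact hm' (hR.symm (hR.trans (hR.trans a (hR.symm b)) (hR.symm ht)))
  · -- R m₁ᶜ uᶜ, R m₂ᶜ u : uᶜ ~ m₁ᶜ ~ m₂ᶜ ~ u
    exact hu' (hR.symm (hR.trans (hR.trans (hR.symm a) ht') b))

/-- **(AMS) with bottom witnesses (weighted, any symmetric weight).**  If every `u ∈ S` admits same-type witnesses `m₁ ⊆ u`, `m₂ ⊆ uᶜ` in `S`
(`R m₁ m₂`, `R m₁ᶜ m₂ᶜ`) — e.g. if `∅ ∈ S`, or if every point of `S` contains a point of one fixed class `X_t` — then `S ⊆ J ∪ Jᶜˢ` and hence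
`Σ_{x∈S} ω x ≤ 2·Σ_{u ∈ J(S,R)} ω u` for every complement-invariant `ω ≥ 0` (no FKG hypothesis needed). [this work] -/
theorem amsIneq_of_witnesses (ω : Finset κ → ℝ) (hω₀ : ∀ s, 0 ≤ ω s) (hsym : ∀ s, ω sᶜ = ω s)
    (S : Finset (Finset κ)) (R : Finset κ → Finset κ → Prop) (hR : Equivalence R) (hScl : ∀ x ∈ S, xᶜ ∈ S) (hanti : ∀ x ∈ S, ¬ R x xᶜ)
    (hwit : ∀ u ∈ S, ∃ m₁ ∈ S, ∃ m₂ ∈ S, m₁ ⊆ u ∧ m₂ ⊆ uᶜ ∧ R m₁ m₂ ∧ R m₁ᶜ m₂ᶜ) :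
    ∑ x ∈ S, ω x ≤ 2 * ∑ u ∈ ((S ×ˢ S).filter (fun p => ¬ R p.1 p.2 ∧ ¬ R p.1ᶜ p.2ᶜ)).image (fun p => p.1 ∪ p.2), ω u := by
  set J := ((S ×ˢ S).filter (fun p => ¬ R p.1 p.2 ∧ ¬ R p.1ᶜ p.2ᶜ)).image (fun p => p.1 ∪ p.2) with hJ
  have hcov : S ⊆ J ∪ Jᶜˢ := by
    intro u hu
    obtain ⟨m₁, hm₁, m₂, hm₂, h₁, h₂, ht, ht'⟩ := hwit u hu
    rcases mem_amsUnions_or_compl_mem_of_witnesses S R hR hScl hanti hu hm₁ hm₂ h₁ h₂ ht ht' with h | h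
    · exact mem_union.2 (Or.inl h)
    · exact mem_union.2 (Or.inr (mem_compls.2 h))
  calc ∑ x ∈ S, ω x ≤ ∑ x ∈ J ∪ Jᶜˢ, ω x := sum_le_sum_of_subset_of_nonneg hcov fun x _ _ => hω₀ x
    _ = ∑ x ∈ J, ω x + ∑ x ∈ Jᶜˢ \ J, ω x := by rw [← sum_union disjoint_sdiff, union_sdiff_self_eq_union]
    _ ≤ ∑ x ∈ J, ω x + ∑ x ∈ Jᶜˢ, ω x := by
        have : ∑ x ∈ Jᶜˢ \ J, ω x ≤ ∑ x ∈ Jᶜˢ, ω x := sum_le_sum_of_subset_of_nonneg sdiff_subset fun x _ _ => hω₀ x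
        linarith
    _ = 2 * ∑ x ∈ J, ω x := by rw [sum_compls_eq ω hsym J]; ring

/-- **(AMS) whenever `∅ ∈ S`** (equivalently `univ ∈ S`): for every equivalence relation `R` with `¬R x xᶜ` on the complement-closed family
`S ∋ ∅` and every complement-invariant `ω ≥ 0`, `Σ_S ω ≤ 2·Σ_{J(S,R)} ω`.  In particular (AMS) holds for the full cube with any labelling.
[this work] -/
theorem amsIneq_of_empty_mem (ω : Finset κ → ℝ) (hω₀ : ∀ s, 0 ≤ ω s) (hsym : ∀ s, ω sᶜ = ω s)
    (S : Finset (Finset κ)) (R : Finset κ → Finset κ → Prop) (hR : Equivalence R) (hScl : ∀ x ∈ S, xᶜ ∈ S) (hanti : ∀ x ∈ S, ¬ R x xᶜ)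
    (h0 : (∅ : Finset κ) ∈ S) :
    ∑ x ∈ S, ω x ≤ 2 * ∑ u ∈ ((S ×ˢ S).filter (fun p => ¬ R p.1 p.2 ∧ ¬ R p.1ᶜ p.2ᶜ)).image (fun p => p.1 ∪ p.2), ω u :=
  amsIneq_of_witnesses ω hω₀ hsym S R hR hScl hanti fun _ _ =>
    ⟨∅, h0, ∅, h0, empty_subset _, empty_subset _, hR.refl _, hR.refl _⟩

end TwistedAD

end Summit.CriticalPhenomena.PercolationContinuityZ3.Theorems
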